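import Summits.BirchSwinnertonDyer.BirchSwinnertonDyer.Theorems.PrintCf2SplitBadTwoRestrictedControlOfLocSurjBV
import Summits.BirchSwinnertonDyer.BirchSwinnertonDyer.Theorems.PrintCf2SplitBadTwoRestrictedSelmerConjTransportFrame
import HarnessLib

/-!
# Crux `PrintCf2.SplitBadTwoRankOneOfFacts` (stmt-BirchSwinnertonDyer-20368), road α v10.3 — S3c assembly, ELEVENTH CUT: (CT-𝔖) DISCHARGED
# `stub_restrictedControl_two` ⟸ [Poitou–Tate for Ш, cd₂ ≤ 2] ∧ (LS)-under-finiteness ∧ (R-BV)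

Cell `bsd-print-cf2`, LEAD seat `bsd-line-cf2-p1` g12 (prover-bsd-line-cf2-p1-g12-0); `--supports stmt-BirchSwinnertonDyer-20368` (helper, Theses-free).
HONEST FRAMING: proves the registered statement of S3c from DISPLAYED HYPOTHESES, two of which are the tree's NAMED (unproved, published) facts
`poitouTate_sha_tateDual` [Harari 2020 Thm. 17.13] and `fieldCdLE_two_of_numberField` [Serre, Galois Cohomology II §4.4 Prop. 13]; BSD is not proved
by any of this; no summit statement is proved by this seat. No definition, no `sorry`.

WHAT CHANGED AGAINST CUT 10 (`restrictedControl_two_of_locSurj_bv`, p672187). The conjugate-summand finiteness transport (CT-𝔖)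
«`Finite 𝔖_{v̄}(K, W*) → Finite 𝔖_v(K, W*′)`, `W*′ = (E_K)[2^∞]^{(π = 1 − r)}`» is now a THEOREM of the tree on every frame: -w2 g10's
`ConjTransport.finite_restrictedSelmerBase_conj_of_finite` (transport of structure along a lift of complex conjugation, which maps the `(π, r)`-eigenspace
to the `(π, 1 − r)`-eigenspace and `v̄ ↦ v`; files `…RestrictedSelmerConjTransport`, `…ConjTransportPlaces`, `…ConjTransportFrame`). So the displayed
content of S3c is: the two Literature facts, **(LS)-under-finiteness** (`hLSfin`, -w4 g9's text: level-`K` local surjectivity for `W*` away from `v` given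
`Finite 𝔖_{v̄}(K, W*)`; -w4 g9 `locSurj_of_proj` p671851 + 6c in flight, -w5 g3 glue) and **(R-BV)** (`hBV`, cut-7 text; -w7 g2 `rBV_of_three_factor_values`
⟸ (F1)(F2 ⟸ H1″)(F3)(H1′)(H2): -w3 g9, -w7 g3, -w8 g2, -w6 g3). `e_C` as in cut 10. DISCHARGE AGAINST THIS CUT.
presearch: not applicable (assembly of tree theorems). beyond-print theorem: no.

References: [Agboola2007] §3 Prop. 3.2, §5, §6 Prop. 6.10–6.11, Prop. 8.1; [GreenbergLNM1716] §3 Lemmas 3.1–3.3, §4 Lemma 4.2; [Harari2020] Thm. 17.13;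
[SerreGaloisCohomology1997] II §4.4 Prop. 13.
-/

noncomputable section

open scoped Classical

set_option linter.dupNamespace false
set_option autoImplicit false

open NumberField IsDedekindDomain Field WeierstrassCurve
open Literature.NumberTheory.EllipticCurves Literature.NumberTheory.EllipticCurves.GreenbergSelmer
open Literature.NumberTheory.EllipticCurves.Agboola2007
open Literature.NumberTheory.EllipticCurves.IwasawaAlgebra
open Literature.NumberTheory.EllipticCurves.IwasawaDual
open Literature.NumberTheory.EllipticCurves.ResKernel
open Literature.NumberTheory.GaloisRepresentations
open Literature.NumberTheory.GaloisCohomology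
open Summit.BirchSwinnertonDyer.BirchSwinnertonDyer.Theorems.PrintCf2.AdditiveAtSeven
open Summit.BirchSwinnertonDyer.BirchSwinnertonDyer.Theorems.GoldfeldGoodTwists

namespace Summit.BirchSwinnertonDyer.BirchSwinnertonDyer.Theorems.PrintCf2.RestrictedSelmerPair

/-- **S3c `stub_restrictedControl_two` — ELEVENTH CUT: ⟸ `poitouTate_sha_tateDual` ∧ `fieldCdLE_two_of_numberField` ∧ (LS)-under-finiteness ∧ (R-BV)**;
(CT-𝔖) of cut 10 supplied by -w2 g10's `ConjTransport.finite_restrictedSelmerBase_conj_of_finite`; everything else as in cut 10. CONDITIONAL on the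
displayed hypotheses (two of them named Literature facts).
[cite: Agboola2007, §3 Prop. 3.2, §6 Prop. 6.10–6.11, §8 Prop. 8.1] [cite: GreenbergLNM1716, §3 Lemmas 3.1–3.3, §4 Lemma 4.2] [cite: Harari2020, Thm. 17.13] -/
theorem restrictedControl_two_of_locSurj_bv'
    (hPT : ∀ (K : Type) [Field K] [NumberField K], poitouTate_sha_tateDual K) (hcd : fieldCdLE_two_of_numberField)
    (hLSfin : ∀ (d : ℤ), d ≠ 0 → Squarefree d → d % 4 ≠ 1 →
      ∀ (W : WeierstrassCurve ℚ) [W.IsElliptic] (C : VariableChange ℚ), C • W = cm7.quadraticTwist (d : ℚ) →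
      ∀ (K : Type) [Field K] [NumberField K], IsImaginaryQuadratic K →
      ∀ (v vbar : HeightOneSpectrum (𝓞 K)),
        ((2 : ℕ) : 𝓞 K) ∈ v.asIdeal → ((2 : ℕ) : 𝓞 K) ∈ vbar.asIdeal → vbar ≠ v →
      ∀ (π : (W.baseChange K).endRing), (π : AddMonoid.End (W.baseChange K).geomPoints) * π = π - 2 →
      ∀ (r : ℤ_[2]), r * r = r - 2 →
      Finite (restrictedSelmerBase ↥((W.baseChange K).endEigenPrimaryTorsion 2 π r) 2 vbar) →
      ∀ (S : Finset (HeightOneSpectrum (𝓞 K))), (∀ w ∈ S, ((2 : ℕ) : 𝓞 K) ∉ w.asIdeal ∨ w = vbar) →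
      ∀ τ : (w : HeightOneSpectrum (𝓞 K)) → subgroupH1 (decomp (K := K) w) ↥((W.baseChange K).endEigenPrimaryTorsion 2 π r),
      ∃ g : discreteH1 (absoluteGaloisGroup K) ↥((W.baseChange K).endEigenPrimaryTorsion 2 π r),
        (∀ w ∈ S, ResKernel.resSubgroup (decomp (K := K) w) ↥((W.baseChange K).endEigenPrimaryTorsion 2 π r) g = τ w) ∧
        (∀ w : HeightOneSpectrum (𝓞 K), w ∉ S → ((2 : ℕ) : 𝓞 K) ∉ w.asIdeal →
          ResKernel.resSubgroup (decomp (K := K) w) ↥((W.baseChange K).endEigenPrimaryTorsion 2 π r) g = 0))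
    (hBV : ∃ eK : ℤ → ℤ → ℤ, ∀ (d : ℤ), d ≠ 0 → Squarefree d → d % 4 ≠ 1 →
      ∀ (W : WeierstrassCurve ℚ) [W.IsElliptic] [W.IsGloballyMinimal] (C : VariableChange ℚ),
        C • W = cm7.quadraticTwist (d : ℚ) → W.analyticRank = 1 →
      ∀ (K : Type) [Field K] [NumberField K], IsImaginaryQuadratic K →
      ∀ (v vbar : HeightOneSpectrum (𝓞 K)),
        ((2 : ℕ) : 𝓞 K) ∈ v.asIdeal → ((2 : ℕ) : 𝓞 K) ∈ vbar.asIdeal → vbar ≠ v →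
      ∀ (π : (W.baseChange K).endRing), (π : AddMonoid.End (W.baseChange K).geomPoints) * π = π - 2 →
      ∀ (r : ℤ_[2]), r * r = r - 2 →
        (∀ τ ∈ GreenbergSelmer.inertia v, ∀ x : ↥((W.baseChange K).endEigenPrimaryTorsion 2 π r), τ • x = x ∨ τ • x = -x) →
      ∀ (P : W.toAffine.Point) (c₀ : ℕ) (ℓ : ℤ),
        ¬ IsOfFinAddOrder P →
        (∀ R : W.toAffine.Point, ∃ (k : ℤ) (T : W.toAffine.Point), IsOfFinAddOrder T ∧ R = k • P + T) →
        c₀ ≠ 0 → (W.baseChange ℚ_[2]).IsInReductionKernel (c₀ • W.toPadicPoint 2 P) →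
        ‖(W.baseChange ℚ_[2]).padicLogPoint (c₀ • W.toPadicPoint 2 P) / (c₀ : ℚ_[2])‖ = (2 : ℝ) ^ (-ℓ) →
      Finite (restrictedSelmerBase ↥((W.baseChange K).endEigenPrimaryTorsion 2 π r) 2 vbar) →
        (padicValNat 2 (Nat.card (restrictedSelmerBase ↥((W.baseChange K).endEigenPrimaryTorsion 2 π r) 2 vbar)) : ℤ) =
          (padicValNat 2 (Nat.card (AddCommGroup.primaryComponent W.sha 2)) : ℤ) + 2 * ℓ + eK (d % 2) ((d / (2 - d % 2)) % 8)) :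
    -- CONCLUSION: S3c `stub_restrictedControl_two`, v9 = v10.3 VERBATIM
    -- CONCLUSION: S3c `stub_restrictedControl_two`, v9 = v10.3 VERBATIM
    ∃ eC : ℤ → ℤ → ℤ,
    ∀ (d : ℤ), d ≠ 0 → Squarefree d → d % 4 ≠ 1 →
    ∀ (W : WeierstrassCurve ℚ) [W.IsElliptic] [W.IsGloballyMinimal] (C : VariableChange ℚ),
      C • W = cm7.quadraticTwist (d : ℚ) → W.analyticRank = 1 →
    ∀ (K : Type) [Field K] [NumberField K], IsImaginaryQuadratic K →
    ∀ (v vbar : HeightOneSpectrum (𝓞 K)),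
      ((2 : ℕ) : 𝓞 K) ∈ v.asIdeal → ((2 : ℕ) : 𝓞 K) ∈ vbar.asIdeal → vbar ≠ v →
    ∀ (π : (W.baseChange K).endRing), (π : AddMonoid.End (W.baseChange K).geomPoints) * π = π - 2 →
    ∀ (r : ℤ_[2]), r * r = r - 2 →
      (∀ τ ∈ GreenbergSelmer.inertia v, ∀ x : ↥((W.baseChange K).endEigenPrimaryTorsion 2 π r), τ • x = x ∨ τ • x = -x) →
    ∀ (κ' : ZpExtension K 2), κ'.IsUnramifiedOutside vbar → ∀ (γ' : absoluteGaloisGroup K), κ'.IsTopGenerator γ' →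
    ∀ (D : Agboola2007.RestrictedDualData κ' ↥((W.baseChange K).endEigenPrimaryTorsion 2 π r) vbar γ') (n : ℕ),
      Module.Finite (IwasawaAlgebra 2) D.X → D.HasCharValuationAt n →
    ∀ (P : W.toAffine.Point) (c₀ : ℕ) (ℓ : ℤ),
      ¬ IsOfFinAddOrder P →
      (∀ R : W.toAffine.Point, ∃ (k : ℤ) (T : W.toAffine.Point), IsOfFinAddOrder T ∧ R = k • P + T) →
      c₀ ≠ 0 → (W.baseChange ℚ_[2]).IsInReductionKernel (c₀ • W.toPadicPoint 2 P) →
      ‖(W.baseChange ℚ_[2]).padicLogPoint (c₀ • W.toPadicPoint 2 P) / (c₀ : ℚ_[2])‖ = (2 : ℝ) ^ (-ℓ) →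
      (n : ℤ) = ((padicValNat 2 (Nat.card (AddCommGroup.primaryComponent W.sha 2)) : ℤ)
            + (padicValNat 2 W.tamagawaProduct : ℤ)
            - 2 * (padicValNat 2 W.torsionOrder : ℤ) + 2 * ℓ) + eC (d % 2) ((d / (2 - d % 2)) % 8) := by
  haveI : Fact (Nat.Prime 2) := ⟨Nat.prime_two⟩
  exact restrictedControl_two_of_locSurj_bv hPT hcd
    (fun _ _ _ _ W _ _ _ K _ _ hK v vbar hv hvbar hne π hrel r _ hfin ↦
      ConjTransport.finite_restrictedSelmerBase_conj_of_finite W K hK v vbar hv hvbar hne π hrel r hfin)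
    hLSfin hBV

end Summit.BirchSwinnertonDyer.BirchSwinnertonDyer.Theorems.PrintCf2.RestrictedSelmerPair

end
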